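import Literature.Topology.FourManifolds.BlowUpChartIdentities
import HarnessLib

/-!
# Blowing up a plumbing point: the second sheet's tube in the chart at `[0 : 1 : 0]`

Topic `Literature/Topology/FourManifolds`; companion of `BlowUpChartIdentities.lean` (block 2 of
Akhmedov–Park's `X₁(m)`, A. Akhmedov, B. D. Park, Invent. Math. 181 (2010), §3: the blow-up of the
double point `x₃ × y₀` of `S₁ ∪ S₂` in `T⁴`, presented as the Kervaire–Milnor sum with `ℂℙ²`).
That file computes the Kervaire–Milnor partner of a tube point `(a, a ν)` of the FIRST sheet
`{(a, 0)}` in the affine chart at `[1 : 0 : 0]`; this file does the same for the SECOND sheet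
`{(0, b)}`, whose tube points are `(b ν, b)`, in the affine chart at `[0 : 1 : 0]`:

  `(affineChart 2)⁻¹ (ψ (b ν, b)) = (affineChart 1)⁻¹ (ν, conj b̂ • s/(1 - ‖b‖ s))`,
  `s = √(1 + ‖ν‖²)`, `‖b‖ s < 1`

(`affineChart_two_symm_discInversion_sheetTube₂`), the far-zone value of the second sheet's cap tube
(`BlowUpLineCapTube.lean` with the roles of the coordinates exchanged).  Everything is proved; no
definitions.

## References

* M. Kervaire, J. Milnor, *Groups of homotopy spheres I*, Ann. of Math. 77 (1963), §2. [KervaireMilnor1963]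
* D. McDuff, D. Salamon, *Introduction to Symplectic Topology*, 3rd ed. (2017), Example 7.1.9. [McDuffSalamon2017]
-/

noncomputable section

open scoped Topology ComplexConjugate
open Set Function Complex
open Literature.Topology.FourManifolds.ToricBlowup
open Literature.Topology.FourManifolds.ComplexProjectiveSpace

namespace Literature.Topology.FourManifolds

namespace BlowUpCap

/-- `‖(b ν, b)‖ = ‖b‖ √(1 + ‖ν‖²)` in `ℝ⁴`. [folklore] -/
theorem norm_fromC2_sheetTube₂ (b ν : ℂ) :
    ‖fromC2 (b * ν, b)‖ = ‖b‖ * Real.sqrt (1 + ‖ν‖ ^ 2) := by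
  have h : ‖fromC2 (b * ν, b)‖ ^ 2 = (‖b‖ * Real.sqrt (1 + ‖ν‖ ^ 2)) ^ 2 := by
    rw [norm_fromC2_sq, Complex.normSq_eq_norm_sq, Complex.normSq_eq_norm_sq, norm_mul, mul_pow,
      mul_pow, Real.sq_sqrt (by positivity)]
    ring
  exact (pow_left_inj₀ (norm_nonneg _) (by positivity) two_ne_zero).1 h

/-- Kervaire–Milnor's inversion of the second sheet's tube point: `ψ (b ν, b) = (λ b ν, λ b)`,
`λ = (1 - ‖b‖ s)/(‖b‖ s)`. [cite: KervaireMilnor1963, §2] -/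
theorem discInversionFun_fromC2_sheetTube₂ (b ν : ℂ) :
    discInversionFun (fromC2 (b * ν, b)) =
      fromC2 ((((1 - ‖b‖ * Real.sqrt (1 + ‖ν‖ ^ 2)) * (‖b‖ * Real.sqrt (1 + ‖ν‖ ^ 2))⁻¹ : ℝ) : ℂ) *
          (b * ν),
        (((1 - ‖b‖ * Real.sqrt (1 + ‖ν‖ ^ 2)) * (‖b‖ * Real.sqrt (1 + ‖ν‖ ^ 2))⁻¹ : ℝ) : ℂ) * b) := by
  apply toC2_injective
  rw [discInversionFun, norm_fromC2_sheetTube₂, toC2_smul, toC2_fromC2, toC2_fromC2]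

/-- The projective scaling `[λ b ν : λ b : 1] = [ν : 1 : (λ b)⁻¹]` (`λ b ≠ 0`). [folklore] -/
theorem pt_sheetTube₂_eq {b ν : ℂ} {μ : ℝ} (hb : b ≠ 0) (hμ : μ ≠ 0)
    (h1 : (![((μ : ℝ) : ℂ) * (b * ν), ((μ : ℝ) : ℂ) * b, 1] : Fin 3 → ℂ) ≠ 0)
    (h2 : (![ν, 1, (((μ : ℝ) : ℂ) * b)⁻¹] : Fin 3 → ℂ) ≠ 0) :
    pt ![((μ : ℝ) : ℂ) * (b * ν), ((μ : ℝ) : ℂ) * b, 1] h1 = pt ![ν, 1, (((μ : ℝ) : ℂ) * b)⁻¹] h2 := by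
  have hμc : ((μ : ℝ) : ℂ) ≠ 0 := Complex.ofReal_ne_zero.2 hμ
  have hμb : ((μ : ℝ) : ℂ) * b ≠ 0 := mul_ne_zero hμc hb
  refine pt_eq_pt_of_smul h1 h2 (((μ : ℝ) : ℂ) * b) ?_
  funext j
  fin_cases j
  · simp; ring
  · simp
  · simp; field_simp

/-- **The second sheet's tube point in the chart at `[0 : 1 : 0]`.**  For `b ≠ 0` and
`‖b‖ s < 1`, `s = √(1 + ‖ν‖²)`, the Kervaire–Milnor partner `(affineChart 2)⁻¹ (ψ (b ν, b))` of
the tube point `(b ν, b)` of the sheet `{(0, b)}` is `(affineChart 1)⁻¹ (ν, conj b̂ • s/(1 - ‖b‖ s))`,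
i.e. `[ν : 1 : conj b̂ • s/(1 - ‖b‖ s)]`. [cite: KervaireMilnor1963, §2] [cite: McDuffSalamon2017, Example 7.1.9] -/
theorem affineChart_two_symm_discInversion_sheetTube₂ {b ν : ℂ} (hb : b ≠ 0)
    (hlt : ‖b‖ * Real.sqrt (1 + ‖ν‖ ^ 2) < 1) :
    (affineChart (n := 2) 2).symm (discInversionFun (fromC2 (b * ν, b))) =
      (affineChart (n := 2) 1).symm (fromC2 (ν, conj (((‖b‖⁻¹ : ℝ) : ℂ) * b) *
        (Real.sqrt (1 + ‖ν‖ ^ 2) / (1 - ‖b‖ * Real.sqrt (1 + ‖ν‖ ^ 2)) : ℝ))) := by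
  set s : ℝ := Real.sqrt (1 + ‖ν‖ ^ 2) with hs
  have hs1 : 1 ≤ s := Real.one_le_sqrt.2 (by nlinarith [norm_nonneg ν])
  have hn : 0 < ‖b‖ := norm_pos_iff.2 hb
  have hbs : 0 < ‖b‖ * s := by positivity
  set μ : ℝ := (1 - ‖b‖ * s) * (‖b‖ * s)⁻¹ with hμ
  have hμ0 : μ ≠ 0 := mul_ne_zero (by linarith) (inv_ne_zero hbs.ne')
  rw [discInversionFun_fromC2_sheetTube₂, affineChart_two_symm, toC2_fromC2, affineChart_one_symm,
    toC2_fromC2]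
  simp only
  rw [pt_sheetTube₂_eq hb hμ0 _ (vec3_ne_zero 1 (by simp))]
  apply pt_congr
  rw [inv_real_mul_eq]
  have hd : 1 - ‖b‖ * s ≠ 0 := by linarith
  have hs0 : s ≠ 0 := by linarith
  have h3 : (((μ * ‖b‖)⁻¹ : ℝ) : ℂ) = ((s / (1 - ‖b‖ * s) : ℝ) : ℂ) := by
    congr 1
    rw [hμ]
    field_simp
  rw [h3]

end BlowUpCap

end Literature.Topology.FourManifolds
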